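import Summits.CriticalPhenomena.PercolationContinuityZ3.Theorems.PercNearOneGluingNoHeavyLowerTailSunflowerRainbowComplementReading
import HarnessLib
import HarnessLib.Audit

/-!
# `NoHeavyLowerTail` (crux stmt-CriticalPhenomena-4575), abstract sunflower cubic: `RainbowKernelIndependence` HOLDS FOR EVERY
# SUNFLOWER WHOSE PETAL 1 IS AN INTERSECTING FAMILY — an explicit left inverse of the two-stage rainbow vectors (part 2 of 2 of gen 20)

Support file (seat `prim-l12-p2` gen 20; `--supports stmt-CriticalPhenomena-4575`).  No `sorry`, no new definitions.
Memo: run/shared/lean/prim/prim-l12/prim-l12-p2/FINDING-g20-COMPLEMENT-READING.md.  Part 1: `…SunflowerRainbowComplementReading`.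

* `Sunflower.kB_rbVec` — **EXACT LEFT INVERSE**: if petal 1 is intersecting (any two label-1 sets meet), the functional
  `k_ρ' = Σ_{S ⊆ Q3', lab S = 0, lab (Q1'ᶜ∖S) = 4} N_{Q1'ᶜ}(S,Q3') · (e_S ⊗ M-row of Sᶜ ∖ Q1')` satisfies `⟨k_ρ', rbVec ρ⟩ = [ρ = ρ']`
  for all rainbows `ρ, ρ'` (part 1's `rbVec_read_compl`, then the cube theorem `crossKey` in the cube `Q1ᶜ`).
* `Sunflower.rbVec_linearIndependent_of_intersecting` — hence the rainbow vectors of such a sunflower are linearly independent: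
  the typed conjecture `RainbowKernelIndependence` (gen 18, `…SunflowerRainbowReduction`) restricted to sunflowers with an
  intersecting petal 1 is a THEOREM (census for the rest: memo §1).
* `Sunflower.ZH_nonneg_of_rbVec_linearIndependent` — the per-sunflower form of gen 18's reduction (rank–nullity in `GF(2)^{sup}`),
  and the corollary `Sunflower.ZH_nonneg_of_intersecting_petal_one` (★ for these sunflowers; known since gen 17 by the Hall–Gladkov
  route — recorded as the first instance of "RKI on a class ⇒ ★ on the class").
-/

namespace Summit.CriticalPhenomena.PercolationContinuityZ3.Theorems.SunflowerPartition

open Finset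

namespace Sunflower

variable {α : Type*} [Fintype α] [DecidableEq α] (F : Sunflower α)

/-! ## The explicit left inverse for an intersecting petal 1 -/

/-- The second block of a disjoint pair is recovered from the first and the third. [folklore] -/
theorem snd_eq_compl_sdiff {ρ : Finset α × Finset α} (h : Disjoint ρ.1 ρ.2) : ρ.2 = ρ.1ᶜ \ (ρ.1 ∪ ρ.2)ᶜ :=
  (compl_sdiff_third h).symm

/-- **EXACT LEFT INVERSE** (this work).  If petal 1 is an intersecting family, then for all rainbows `ρ, ρ'` the functional
`k_ρ' = Σ_{S ⊆ Q3', lab S = 0, lab (Q1'ᶜ∖S) = 4} N_{Q1'ᶜ}(S,Q3') · (e_S ⊗ M-row of Sᶜ ∖ Q1')` satisfies `⟨k_ρ', rbVec ρ⟩ = [ρ = ρ']`: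
by `rbVec_read_compl` each term reads `N(S,Q3')·M(Q3_ρ,S)·[Q1 = Q1']`, and `Σ_S M(Q3_ρ,S)N(S,Q3') = [Q3_ρ = Q3']` is the cube theorem
`crossKey` in the cube `Q1ᶜ`. [this work] -/
theorem kB_rbVec (hint : ∀ D D' : Finset α, F.lab D = 1 → F.lab D' = 1 → (D ∩ D').Nonempty)
    {ρ ρ' : Finset α × Finset α} (hρ : ρ ∈ F.dem) (hr : F.IsRainbow ρ) (hρ' : ρ' ∈ F.dem) (hr' : F.IsRainbow ρ') :
    (∑ σ ∈ F.sup,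
        (∑ S ∈ ((ρ'.1 ∪ ρ'.2)ᶜ).powerset.filter (fun S => F.lab S = 0 ∧ F.lab (ρ'.1ᶜ \ S) = 4),
            F.certN ρ' S *
              (if σ.2 = S then
                ∑ R' ∈ (Sᶜ).powerset, (if F.lab R' = 0 ∧ (σ.1 ∪ σ.2)ᶜ ⊆ R' ∧ R' ⊆ Sᶜ \ ρ'.1 then (1 : ZMod 2) else 0)
               else 0)) * F.rbVec ρ σ)
      = if ρ = ρ' then 1 else 0 := by
  obtain ⟨hdisj, hQ1, hQ2, hQ3⟩ := F.dem_rainbow_facts hρ hr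
  obtain ⟨hdisj', hQ1', hQ2', hQ3'⟩ := F.dem_rainbow_facts hρ' hr'
  set filtS := ((ρ'.1 ∪ ρ'.2)ᶜ).powerset.filter (fun S => F.lab S = 0 ∧ F.lab (ρ'.1ᶜ \ S) = 4) with hfS
  -- the row functional of `S`
  let row : Finset α → Finset α × Finset α → ZMod 2 := fun S σ =>
    if σ.2 = S then ∑ R' ∈ (Sᶜ).powerset, (if F.lab R' = 0 ∧ (σ.1 ∪ σ.2)ᶜ ⊆ R' ∧ R' ⊆ Sᶜ \ ρ'.1 then (1 : ZMod 2) else 0)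
    else 0
  -- the TS-B coefficient of `ρ` at `S`
  let mS : Finset α → ZMod 2 := fun S =>
    ∑ R' ∈ (Finset.univ : Finset α).powerset, (if F.lab R' = 0 ∧ S ⊆ R' ∧ R' ⊆ (ρ.1 ∪ ρ.2)ᶜ then (1 : ZMod 2) else 0)
  -- STEP 1: exchange the sums
  have step1 : (∑ σ ∈ F.sup, (∑ S ∈ filtS, F.certN ρ' S * row S σ) * F.rbVec ρ σ)
      = ∑ S ∈ filtS, F.certN ρ' S * (∑ σ ∈ F.sup, (if σ.2 = S then
          (∑ R' ∈ (Sᶜ).powerset, (if F.lab R' = 0 ∧ (σ.1 ∪ σ.2)ᶜ ⊆ R' ∧ R' ⊆ Sᶜ \ ρ'.1 then (1 : ZMod 2) else 0)) * F.rbVec ρ σ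
          else 0)) := by
    rw [show (∑ σ ∈ F.sup, (∑ S ∈ filtS, F.certN ρ' S * row S σ) * F.rbVec ρ σ)
        = ∑ σ ∈ F.sup, ∑ S ∈ filtS, F.certN ρ' S * (row S σ * F.rbVec ρ σ) from
      sum_congr rfl fun σ _ => by rw [Finset.sum_mul]; exact sum_congr rfl fun S _ => by ring]
    rw [Finset.sum_comm]
    refine sum_congr rfl fun S _ => ?_
    rw [Finset.mul_sum]
    refine sum_congr rfl fun σ _ => ?_
    simp only [row]
    by_cases h : σ.2 = S
    · rw [if_pos h, if_pos h]
    · rw [if_neg h, if_neg h, zero_mul]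
  rw [step1]
  -- STEP 2: read each `S`
  have step2 : ∀ S ∈ filtS, (∑ σ ∈ F.sup, (if σ.2 = S then
          (∑ R' ∈ (Sᶜ).powerset, (if F.lab R' = 0 ∧ (σ.1 ∪ σ.2)ᶜ ⊆ R' ∧ R' ⊆ Sᶜ \ ρ'.1 then (1 : ZMod 2) else 0)) * F.rbVec ρ σ
          else 0))
        = if F.lab S = 0 ∧ S ⊆ (ρ.1 ∪ ρ.2)ᶜ ∧ F.lab (Sᶜ \ ρ.1) = 4 then mS S * (if ρ'.1 = ρ.1 then 1 else 0) else 0 := by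
    intro S hS
    obtain ⟨hSQ3, hS0, hS4⟩ := mem_filter.1 hS
    rw [mem_powerset] at hSQ3
    have hP'S : ρ'.1 ⊆ Sᶜ := by
      intro x hx; rw [mem_compl]; intro hxS
      have := hSQ3 hxS; rw [mem_compl, mem_union, not_or] at this; exact this.1 hx
    have hriv : ∀ D, D ⊆ Sᶜ \ ρ'.1 → F.lab D ≠ 1 := by
      intro D hD hD1
      obtain ⟨x, hx⟩ := hint D ρ'.1 hD1 hQ1'
      exact (mem_sdiff.1 (hD (mem_inter.1 hx).1)).2 (mem_inter.1 hx).2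
    exact F.rbVec_read_compl hρ hr hS0 hP'S hQ1' hriv
  rw [sum_congr rfl fun S hS => by rw [step2 S hS]]
  -- STEP 3: the case `Q1 ≠ Q1'`
  by_cases heq : ρ'.1 = ρ.1
  swap
  · rw [show (∑ S ∈ filtS, F.certN ρ' S *
          (if F.lab S = 0 ∧ S ⊆ (ρ.1 ∪ ρ.2)ᶜ ∧ F.lab (Sᶜ \ ρ.1) = 4 then mS S * (if ρ'.1 = ρ.1 then 1 else 0) else 0)) = 0 from
      sum_eq_zero fun S _ => by rw [if_neg heq, mul_zero, ite_self, mul_zero]]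
    rw [if_neg]
    rintro rfl
    exact heq rfl
  -- STEP 4: `Q1 = Q1'`: the cube theorem in `Q1ᶜ`
  simp only [heq, if_true, mul_one]
  set W := ρ.1ᶜ with hW
  set Y := (ρ.1 ∪ ρ.2)ᶜ with hY
  set Y'' := (ρ'.1 ∪ ρ'.2)ᶜ with hY''
  have hYW : Y ⊆ W := by
    intro x hx; rw [hY, mem_compl, mem_union, not_or] at hx; exact mem_compl.2 hx.1
  have hY''W : Y'' ⊆ W := by
    intro x hx; rw [hY'', mem_compl, mem_union, not_or] at hx; rw [hW, ← heq]; exact mem_compl.2 hx.1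
  have hWY : W \ Y = ρ.2 := (snd_eq_compl_sdiff hdisj).symm
  have hWY'' : W \ Y'' = ρ'.2 := by rw [hW, ← heq]; exact (snd_eq_compl_sdiff hdisj').symm
  have key := F.crossKey W (Y := Y) (Y'' := Y'') hYW hY''W (by rw [hQ3]; decide) (by rw [hWY, hQ2]; decide)
    (by rw [hQ3']; decide) (by rw [hWY'', hQ2']; decide) (by rw [hWY'', hQ2']; decide) (by rw [hWY'', hQ2', hQ3]; decide)
  -- `[Y = Y''] = [ρ = ρ']`
  have hiff : (if Y = Y'' then (1 : ZMod 2) else 0) = if ρ = ρ' then 1 else 0 := by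
    by_cases h : ρ = ρ'
    · rw [if_pos h, if_pos (by rw [hY, hY'', h])]
    · rw [if_neg h, if_neg]
      intro hYY
      apply h
      have h2 : ρ.2 = ρ'.2 := by rw [← hWY, ← hWY'', hYY]
      exact Prod.ext heq.symm h2
  rw [← hiff, ← key]
  -- compare the two `S`-sums termwise, after extending ours to `W.powerset`
  have hfW : filtS ⊆ W.powerset := fun S hS => mem_powerset.2 ((mem_powerset.1 (mem_filter.1 hS).1).trans hY''W)
  -- our summand, as a function on all `S`
  let g : Finset α → ZMod 2 := fun S =>
    F.certN ρ' S * (if F.lab S = 0 ∧ S ⊆ Y ∧ F.lab (Sᶜ \ ρ.1) = 4 then mS S else 0)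
  have hScQ1 : ∀ S : Finset α, Sᶜ \ ρ.1 = ρ'.1ᶜ \ S := by
    intro S; rw [heq]; ext x; simp only [mem_sdiff, mem_compl]; tauto
  -- `certN ρ' S` is the `N`-factor of `crossKey`
  have hN : ∀ S : Finset α, F.certN ρ' S
      = ∑ R ∈ W.powerset, (if F.lab R = 4 ∧ W \ Y'' ⊆ R ∧ R ⊆ W \ S then (1 : ZMod 2) else 0) := by
    intro S; unfold certN; rw [hW, ← heq]
  have hvanish : ∀ S ∈ W.powerset, S ∉ filtS → g S = 0 := by
    intro S hSW hSf
    have hSW' : S ⊆ W := mem_powerset.1 hSW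
    show F.certN ρ' S * (if F.lab S = 0 ∧ S ⊆ Y ∧ F.lab (Sᶜ \ ρ.1) = 4 then mS S else 0) = 0
    by_cases hc : F.lab S = 0 ∧ S ⊆ Y ∧ F.lab (Sᶜ \ ρ.1) = 4
    · -- then `S ∉ filtS` forces `S ⊄ Y''`, and `certN ρ' S = 0`
      have hS4 : F.lab (ρ'.1ᶜ \ S) = 4 := by rw [← hScQ1]; exact hc.2.2
      have hSY'' : ¬ S ⊆ Y'' := fun h => hSf (mem_filter.2 ⟨mem_powerset.2 h, hc.1, hS4⟩)
      rw [hN S, show (∑ R ∈ W.powerset, (if F.lab R = 4 ∧ W \ Y'' ⊆ R ∧ R ⊆ W \ S then (1 : ZMod 2) else 0)) = 0 from ?_,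
        zero_mul]
      refine sum_eq_zero fun R _ => if_neg fun h => hSY'' fun x hxS => ?_
      by_contra hxY
      have hxW : x ∈ W := hSW' hxS
      have : x ∈ W \ Y'' := mem_sdiff.2 ⟨hxW, hxY⟩
      exact (mem_sdiff.1 (h.2.2 (h.2.1 this))).2 hxS
    · rw [if_neg hc, mul_zero]
  rw [show (∑ S ∈ filtS, F.certN ρ' S * (if F.lab S = 0 ∧ S ⊆ Y ∧ F.lab (Sᶜ \ ρ.1) = 4 then mS S else 0))
      = ∑ S ∈ W.powerset, g S from (Finset.sum_subset hfW hvanish)]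
  refine sum_congr rfl fun S hSW => ?_
  have hSW' : S ⊆ W := mem_powerset.1 hSW
  show F.certN ρ' S * (if F.lab S = 0 ∧ S ⊆ Y ∧ F.lab (Sᶜ \ ρ.1) = 4 then mS S else 0)
    = (∑ R' ∈ W.powerset, (if F.lab R' = 0 ∧ S ⊆ R' ∧ R' ⊆ Y then (1 : ZMod 2) else 0)) *
      (∑ R ∈ W.powerset, (if F.lab R = 4 ∧ W \ Y'' ⊆ R ∧ R ⊆ W \ S then (1 : ZMod 2) else 0))
  rw [← hN S]
  by_cases hc : F.lab S = 0 ∧ S ⊆ Y ∧ F.lab (Sᶜ \ ρ.1) = 4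
  · rw [if_pos hc, mul_comm]
    congr 1
    show (∑ R' ∈ (Finset.univ : Finset α).powerset, (if F.lab R' = 0 ∧ S ⊆ R' ∧ R' ⊆ Y then (1 : ZMod 2) else 0)) = _
    rw [F.sum_pow_to 0 S Y Finset.univ (subset_univ _), F.sum_pow_to 0 S Y W hYW]
  · rw [if_neg hc, mul_zero]
    symm
    by_cases hS0 : F.lab S = 0
    · by_cases hSY : S ⊆ Y
      · have h4 : F.lab (ρ'.1ᶜ \ S) ≠ 4 := fun h => hc ⟨hS0, hSY, by rw [hScQ1]; exact h⟩
        rw [hN S, F.crossN_eq_zero_of_lab_ne W (Y'' := Y'') (by rw [hW, ← heq]; exact h4), mul_zero]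
      · rw [show (∑ R' ∈ W.powerset, (if F.lab R' = 0 ∧ S ⊆ R' ∧ R' ⊆ Y then (1 : ZMod 2) else 0)) = 0 from
          sum_eq_zero fun R' _ => if_neg fun h => hSY (h.2.1.trans h.2.2), zero_mul]
    · rw [F.crossM_eq_zero_of_lab_ne W (Y := Y) hS0, zero_mul]

/-! ## Linear independence and ★ for an intersecting petal 1 -/

/-- **`RainbowKernelIndependence` FOR AN INTERSECTING PETAL 1** (this work): if any two label-1 sets meet, the two-stage rainbow
vectors `rbVec ρ` (`ρ` a rainbow) are linearly independent over `GF(2)` — apply the left inverse `kB_rbVec` to a vanishing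
combination. [this work] -/
theorem rbVec_linearIndependent_of_intersecting
    (hint : ∀ D D' : Finset α, F.lab D = 1 → F.lab D' = 1 → (D ∩ D').Nonempty) :
    LinearIndependent (ZMod 2)
      (fun ρ : ↥(F.dem.filter (fun d => F.IsRainbow d)) => fun σ : ↥F.sup => F.rbVec ρ.1 σ.1) := by
  rw [Fintype.linearIndependent_iff]
  intro g hg ρ'
  have hρ' : ρ'.1 ∈ F.dem := (mem_filter.1 ρ'.2).1
  have hr' : F.IsRainbow ρ'.1 := (mem_filter.1 ρ'.2).2
  -- the certificate functional of `ρ'`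
  let kB : Finset α × Finset α → ZMod 2 := fun σ =>
    ∑ S ∈ ((ρ'.1.1 ∪ ρ'.1.2)ᶜ).powerset.filter (fun S => F.lab S = 0 ∧ F.lab (ρ'.1.1ᶜ \ S) = 4),
      F.certN ρ'.1 S *
        (if σ.2 = S then
          ∑ R' ∈ (Sᶜ).powerset, (if F.lab R' = 0 ∧ (σ.1 ∪ σ.2)ᶜ ⊆ R' ∧ R' ⊆ Sᶜ \ ρ'.1.1 then (1 : ZMod 2) else 0)
         else 0)
  have hpt : ∀ σ : ↥F.sup, (∑ ρ, g ρ * F.rbVec ρ.1 σ.1) = 0 := by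
    intro σ
    have := congrFun hg σ
    simpa [Finset.sum_apply, Pi.smul_apply, smul_eq_mul] using this
  have h0 : (∑ σ : ↥F.sup, kB σ.1 * (∑ ρ, g ρ * F.rbVec ρ.1 σ.1)) = 0 :=
    sum_eq_zero fun σ _ => by rw [hpt σ, mul_zero]
  rw [show (∑ σ : ↥F.sup, kB σ.1 * (∑ ρ, g ρ * F.rbVec ρ.1 σ.1))
      = ∑ ρ, g ρ * (∑ σ : ↥F.sup, kB σ.1 * F.rbVec ρ.1 σ.1) by
    rw [show (∑ σ : ↥F.sup, kB σ.1 * (∑ ρ, g ρ * F.rbVec ρ.1 σ.1))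
        = ∑ σ : ↥F.sup, ∑ ρ, g ρ * (kB σ.1 * F.rbVec ρ.1 σ.1) from
      sum_congr rfl fun σ _ => by rw [Finset.mul_sum]; exact sum_congr rfl fun ρ _ => by ring]
    rw [Finset.sum_comm]
    exact sum_congr rfl fun ρ _ => by rw [Finset.mul_sum]] at h0
  have hpair : ∀ ρ : ↥(F.dem.filter (fun d => F.IsRainbow d)),
      (∑ σ : ↥F.sup, kB σ.1 * F.rbVec ρ.1 σ.1) = if ρ = ρ' then 1 else 0 := by
    intro ρ
    rw [Finset.sum_coe_sort F.sup (fun σ => kB σ * F.rbVec ρ.1 σ)]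
    have := F.kB_rbVec hint (mem_filter.1 ρ.2).1 (mem_filter.1 ρ.2).2 hρ' hr'
    simp only [kB] at this ⊢
    rw [this]
    by_cases h : ρ = ρ'
    · rw [if_pos h, if_pos (congrArg Subtype.val h)]
    · rw [if_neg h, if_neg fun h' => h (Subtype.ext h')]
  rw [sum_congr rfl fun ρ _ => by rw [hpair ρ]] at h0
  simp only [mul_ite, mul_one, mul_zero, Finset.sum_ite_eq', Finset.mem_univ, if_true] at h0
  exact h0

end Sunflower

/-- **★ FROM LINEAR INDEPENDENCE, PER SUNFLOWER** (this work; the per-sunflower form of gen 18's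
`partitionLemmaH_of_rainbowKernelIndependence`): if the rainbow vectors of `F` are linearly independent then `0 ≤ F.ZH`.
Rank–nullity in `GF(2)^{sup}` exactly as in part B. [this work] -/
theorem Sunflower.ZH_nonneg_of_rbVec_linearIndependent {α : Type*} [Fintype α] [DecidableEq α] (F : Sunflower α)
    (hli : LinearIndependent (ZMod 2)
      (fun ρ : ↥(F.dem.filter (fun d => F.IsRainbow d)) => fun σ : ↥F.sup => F.rbVec ρ.1 σ.1)) :
    0 ≤ F.ZH := by
  classical
  set SP := F.dem.filter (fun d => ¬ F.IsRainbow d) with hSP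
  set RB := F.dem.filter (fun d => F.IsRainbow d) with hRB
  let R : Matrix ↥SP ↥F.sup (ZMod 2) := Matrix.of fun d σ => F.specRow d.1 σ.1
  -- (1) the rows of `R` are independent
  have hinj : Function.Injective (Matrix.mulVecLin R.transpose) := by
    rw [← LinearMap.ker_eq_bot, LinearMap.ker_eq_bot']
    intro g hg
    let c : Finset α × Finset α → ZMod 2 := fun d => if hd : d ∈ SP then g ⟨d, hd⟩ else 0
    have hc : ∀ σ ∈ F.sup, (∑ d ∈ SP, c d * F.specRow d σ) = 0 := by
      intro σ hσ
      have h0 : (R.transpose.mulVec g) ⟨σ, hσ⟩ = 0 :=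
        congrFun (show R.transpose.mulVec g = 0 from (Matrix.mulVecLin_apply R.transpose g).symm.trans hg) ⟨σ, hσ⟩
      simp only [Matrix.mulVec, dotProduct, Matrix.transpose_apply, R, Matrix.of_apply] at h0
      rw [← Finset.sum_coe_sort SP]
      refine Eq.trans (sum_congr rfl fun x _ => ?_) h0
      simp only [c, dif_pos x.2]
      ring
    have hz := F.specRows_indep c hc
    funext x
    have := hz x.1 x.2
    simp only [c, dif_pos x.2] at this
    rw [this, Pi.zero_apply]
  -- (2) rank of the row map
  have hrank : Module.finrank (ZMod 2) (LinearMap.range (Matrix.mulVecLin R)) = Fintype.card ↥SP := by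
    have h1 : R.rank = R.transpose.rank := (Matrix.rank_transpose R).symm
    unfold Matrix.rank at h1
    rw [h1, LinearMap.finrank_range_of_inj hinj, Module.finrank_fintype_fun_eq_card]
  -- (3) the rainbow vectors lie in the kernel
  have hker : Submodule.span (ZMod 2) (Set.range (fun ρ : ↥RB => fun σ : ↥F.sup => F.rbVec ρ.1 σ.1))
      ≤ LinearMap.ker (Matrix.mulVecLin R) := by
    rw [Submodule.span_le]
    rintro v ⟨ρ, rfl⟩
    rw [SetLike.mem_coe, LinearMap.mem_ker, Matrix.mulVecLin_apply]
    funext d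
    simp only [Matrix.mulVec, dotProduct, R, Matrix.of_apply, Pi.zero_apply]
    have := F.rbVec_orth (mem_filter.1 ρ.2).1 (mem_filter.1 ρ.2).2 (mem_filter.1 d.2).1 (mem_filter.1 d.2).2
    rw [← Finset.sum_coe_sort F.sup] at this
    exact this
  -- (4) count dimensions
  have hT : Module.finrank (ZMod 2)
      (Submodule.span (ZMod 2) (Set.range (fun ρ : ↥RB => fun σ : ↥F.sup => F.rbVec ρ.1 σ.1))) = Fintype.card ↥RB :=
    finrank_span_eq_card hli
  have hrn := LinearMap.finrank_range_add_finrank_ker (Matrix.mulVecLin R)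
  rw [Module.finrank_fintype_fun_eq_card, hrank] at hrn
  have hle := Submodule.finrank_mono hker
  rw [hT] at hle
  have hcards : Fintype.card ↥SP + Fintype.card ↥RB ≤ Fintype.card ↥F.sup := by omega
  rw [Fintype.card_coe, Fintype.card_coe, Fintype.card_coe] at hcards
  have hdem : F.dem.card = SP.card + RB.card := by
    rw [hSP, hRB, add_comm]; exact (Finset.card_filter_add_card_filter_not _).symm
  rw [F.ZH_eq_six_card_sup_sub_dem]
  have : (F.dem.card : ℤ) ≤ (F.sup.card : ℤ) := by exact_mod_cast (hdem ▸ hcards)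
  linarith

/-- **COROLLARY (★ for an intersecting petal 1, via the GF(2) programme)** (this work): if any two label-1 sets of the sunflower
meet, then `0 ≤ ZH`.  (Known since gen 17 by the Hall–Gladkov route, `Sunflower.ZH_nonneg_of_intersecting`; this is the first
instance of "`RainbowKernelIndependence` on a class ⇒ ★ on the class".) [this work] -/
theorem Sunflower.ZH_nonneg_of_intersecting_petal_one {α : Type*} [Fintype α] [DecidableEq α] (F : Sunflower α)
    (hint : ∀ D D' : Finset α, F.lab D = 1 → F.lab D' = 1 → (D ∩ D').Nonempty) : 0 ≤ F.ZH :=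
  F.ZH_nonneg_of_rbVec_linearIndependent (F.rbVec_linearIndependent_of_intersecting hint)

end Summit.CriticalPhenomena.PercolationContinuityZ3.Theorems.SunflowerPartition
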